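import Mathlib
import Literature.Barriers.ValiantsHypothesis.AlgebraicNaturalProofs
import Literature.Computability.AlgebraicComplexity.RazUniversalCircuits
import Literature.Computability.AlgebraicComplexity.ValiantClasses
import Summits.ValiantsHypothesis.ValiantsHypothesis.Theorems.BarrierLeverDefinableEquationsDefs

/-!
# Crux `BarrierLever.DefinableEquations` (stmt-ValiantsHypothesis-8745), line `registered`
# (raz-tableau) — registered stub `stub_razTopUniversality`

**Raz 2010, Prop. 3.3 (2), for the TOP homogeneous component.**  For every `n ≥ 1`, every size
exponent `b` and every `f ∈ SmallCircuits ℂ n b` (`deg f ≤ n`, `complexity f ≤ n ^ b`), the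
vector of degree-`n` coefficients of `f` is a point of Raz's polynomial map `Γ` on the top
monomials with `razSlots n b = 4 n^b (n+1)²` slots: `razPoint n b y e = coeff e f` for a suitable
labelling `y` and every `e` of degree `n`.

Proof.  The tree's `RazUniversal.exists_labels_of_complexity_le` assumes `g` homogeneous of
degree `r`; we re-run its proof for an arbitrary `f` of complexity `≤ s` and obtain
`OUT(y) = homogeneousComponent r f` (`exists_labels_outVal_eq_homogeneousComponent`): the
straight-line program of an optimal fan-in-two circuit for `f` (`exists_computes_size_eq_complexity`,
`DepthReduction.exists_slp`) is homogenised (`SLP.homogenize`, whose node `(i, Q r)` computes the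
degree-`r` component of line `i` by definition) and embedded into the universal circuit-graph
(`RazUniversal.outVal_labels`); the degenerate outputs `f = X j` (`r = 1`: the leaf labelling;
`r ≥ 2`: the zero labelling) and `f = C c` (zero labelling) are direct.  Then
`razPoint n b y e = coeff e (OUT(y))` (`RazUniversal.coeff_outVal`) and
`coeff e (homogeneousComponent n f) = coeff e f` for `deg e = n`
(`MvPolynomial.coeff_homogeneousComponent`).

Unconditional (axioms `propext`, `Classical.choice`, `Quot.sound`). References: R. Raz, Theory
Comput. 6 (2010), Prop. 3.3, Prop. 2.8, Prop. 2.3; S. Tavenas, Inform. Comput. 240 (2015), Prop. 2.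
-/

-- layout Summits/ValiantsHypothesis/ValiantsHypothesis forces the duplicated namespace component
set_option linter.dupNamespace false

noncomputable section

namespace Summit.ValiantsHypothesis.ValiantsHypothesis.Theorems.BarrierLeverDefinableEquations

open MvPolynomial Literature.Computability.AlgebraicComplexity Literature.Barriers.ValiantsHypothesis
open RazUniversal DepthReduction

/-- **Raz 2010, Prop. 3.3 (2) for a homogeneous component** (with Prop. 2.3/2.8: homogenisation
and embedding): for ANY polynomial `f` computed by a fan-in-two circuit with at most `s` gates and
every `r ≥ 1`, the degree-`r` homogeneous component of `f` is the output `OUT(y)` of the universal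
circuit-graph with `N ≥ 4 s (r+1)²` slots, for a suitable labelling `y` (the straight-line program
is homogenised by `SLP.homogenize`, whose node `(i, Q r)` computes the degree-`r` component of
line `i`, and embedded by `RazUniversal.outVal_labels`). [cite: Raz2010, Prop. 3.3 (p. 158), Prop. 2.8, Prop. 2.3] -/
theorem exists_labels_outVal_eq_homogeneousComponent {σ : Type*} [Fintype σ] [DecidableEq σ]
    {r N s : ℕ} (hr : 1 ≤ r) (hN : 4 * s * (r + 1) ^ 2 ≤ N) {f : MvPolynomial σ ℂ}
    (hc : complexity f ≤ s) :
    ∃ y : Lab σ r N → ℂ, outVal y = homogeneousComponent r f := by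
  classical
  obtain ⟨P, hP2, hPf, hPs⟩ := ArithCircuit.exists_computes_size_eq_complexity f
  obtain ⟨S, hlen, hcases⟩ := exists_slp P hP2
  have hPf' : P.eval = f := hPf
  rcases hcases with ⟨i, hi, hfi⟩ | ⟨j, hfj⟩ | ⟨c, hfc⟩
  · -- the generic case: `f` is the value of line `i`
    have hcard : Fintype.card (S.Node r) ≤ N :=
      (S.card_node_le r).trans ((Nat.mul_le_mul_right _ (Nat.mul_le_mul_left 4
        (by rw [hlen, hPs]; exact hc))).trans hN)
    let emb : S.Node r → Fin N := fun ν => Fin.castLE hcard (Fintype.equivFin _ ν)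
    have hemb : Function.Injective emb := fun ν μ h =>
      (Fintype.equivFin _).injective (Fin.castLE_injective hcard h)
    let ν₀ : S.Node r := (⟨i, hi⟩, SLP.Tag.Q ⟨r, Nat.lt_succ_self r⟩)
    refine ⟨labels (S.homogenize r) r emb ν₀, ?_⟩
    rw [outVal_labels (H := S.homogenize r) hemb hr rfl]
    show homogeneousComponent r (S.val i) = _
    rw [← hfi, hPf']
  · -- `f = z_j`: the leaf labelling if `r = 1`, the zero labelling otherwise
    rw [hPf'] at hfj
    subst hfj
    rcases eq_or_ne r 1 with rfl | hr1
    · refine ⟨Sum.elim (fun _ => 0) (Pi.single (Sum.inl j) 1), ?_⟩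
      rw [outVal_eq]
      simp only [Sum.elim_inr]
      rw [sum_single_one_smul, baseVal_inl, if_pos (by simp),
        homogeneousComponent_of_mem (isHomogeneous_X ℂ j), if_pos rfl]
    · refine ⟨fun _ => 0, ?_⟩
      rw [outVal_zero, homogeneousComponent_of_mem (isHomogeneous_X ℂ j), if_neg hr1]
  · -- `f = C c`: its degree-`r` component vanishes
    rw [hPf'] at hfc
    subst hfc
    refine ⟨fun _ => 0, ?_⟩
    rw [outVal_zero, homogeneousComponent_of_mem (isHomogeneous_C σ c), if_neg (by omega)]

/-- **Registered stub `stub_razTopUniversality`** (Raz 2010, Prop. 3.3 (2), top component): for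
`n ≥ 1` and `f ∈ SmallCircuits ℂ n b`, the degree-`n` coefficients of `f` are a Raz point with
`razSlots n b = 4 n^b (n+1)²` slots: `razPoint n b y e = coeff e f` for some labelling `y` and all
top monomials `e`. [cite: Raz2010, Prop. 3.3 (p. 158)] -/
theorem stub_razTopUniversality :
    ∀ n b : ℕ, 1 ≤ n → ∀ f ∈ SmallCircuits ℂ n b,
      ∃ y : RazUniversal.Lab (Fin n) n (razSlots n b) → ℂ,
        ∀ e : topMonomials n, razPoint n b y e = coeff (e : Fin n →₀ ℕ) f := by
  intro n b hn f hf
  obtain ⟨-, hc⟩ := hf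
  obtain ⟨y, hy⟩ := exists_labels_outVal_eq_homogeneousComponent (σ := Fin n) (r := n)
    (N := razSlots n b) (s := n ^ b) hn le_rfl hc
  refine ⟨y, fun e => ?_⟩
  show eval y (uCoeff ℂ (Fin n) n (razSlots n b) (e : Fin n →₀ ℕ)) = _
  rw [← coeff_outVal, hy, coeff_homogeneousComponent,
    if_pos (show (e : Fin n →₀ ℕ).degree = n from e.2)]

end Summit.ValiantsHypothesis.ValiantsHypothesis.Theorems.BarrierLeverDefinableEquations

end
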